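import Literature.MathematicalPhysics.QuantumFieldTheory.Balaban1983to89.B9Thm39CinvAtCover
import Literature.MathematicalPhysics.QuantumFieldTheory.Balaban1983to89.B9Cor36CubeTwinsGeometry
import Literature.MathematicalPhysics.QuantumFieldTheory.Balaban1983to89.B9Eq3104CutoffCommutators

/-!
# `Balaban1983to89.B9Eq3105ZetaY` — THE CUT-OFF `ζ_□̃` OF (3.105) OF RECORD ON def-Y's MEMBER CARRIERS: the indicator of `□̃ = QbigT □` on the member's blocks,
# lifted to sites and bonds; `ζ_□̃h_□ = h_□`, `|ζ_□̃| ≤ 1`, `supp ζ_□̃ ⊂ □̃`, `supp(1 − ζ_□̃) ∩ □̃ = ∅`, and the separation `D_sep = M∕(2L²) ≤ d(supp(1 − ζ_□̃), supp h_□)`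
# in the member's block distance (sub-row G-B9-LETTERS, families 2–4 of (3.105) for M5.7's `hrest` ∕ `hV′`; lead g34 RULING FAMFOUR SPLIT 2026-08-28, item (b))

statement-level skeleton of published theorems with citation tags; proofs where landed; nothing here is a claim about the Yang–Mills mass gap

THE PRINTED LOCUS (verbatim as read by the [B9] page owner r06 off the render, `B9Eq3105Sum` l.36–39; held `paper:balaban1985-cmp99-background-propagators`,
journal page = PDF page + 388, text layer p0026 l.30–36).  p. 414 (3.105): «Δ_aG₀ = I − Σ_□K(h_□)G_□h_□ − Σ_□(1 − ζ_□̃)DPD*h_□G_□h_□ − Σ_□ζ_□̃(DPD* − DP_□D*)h_□G_□h_□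
− Σ_□ζ_□̃P_{□,1}(∂h_□)G_□h_□ = I − R, where the function ζ_□̃ is defined similarly to h_□, i.e. ζ_□̃ ∈ C₀^∞(□̃) and ζ_□̃ = 1 on a cube containing □, whose boundary is
in a distance ≧ ⅔M to the boundary of □. This implies that supp h_□ is separated from supp (1 − ζ_□̃) by a distance ≧ M.»; p. 408 («□̃ⁿ … with the same center as
□»); p. 411 («separated at least by a distance MLʲη»); [4] p. 239 («ζ_□ ∈ C₀^∞(□̃)»), (2.83) p. 237, (2.46) p. 231, (2.36) p. 229.

WHY THIS FILE.  M5.7's consumer `B9Thm310DeltaAIsUnitOfExpansion.eBlock_kernelFamilyBInv_GAY_of_localInverseCubes''` takes an ARBITRARY family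
`ζ : cubes → SiteY i → ℝ` with the single hypothesis `hζ : h_□(z) ≠ 0 → ζ_□(z) = 1` and displays the three ζ-words of (3.105) (`(1 − ζ_□̃)DPD*h_□O_□h_□`,
`ζ_□̃(DPD* − P_□)h_□O_□h_□`, `ζ_□̃P_{□,1}O_□h_□`) as the families of `hrest` ∕ `hV′`.  Every supplier of those families needs ONE ζ of record with: `|ζ| ≦ 1` (family 4,
programme FAMFOUR), `ζh_□ = h_□` (the consumer's `hζ`), `supp ζ ⊂ □̃` (family 3: the rows where `DPD*` is compared with `DP_□D*`), and `supp(1 − ζ)` SEPARATED from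
`supp h_□` in the member's distance (family 2, programme ZETA-2: [4] (2.83)'s separated-middle geometry).  THIS FILE fixes that ζ — the indicator of p21's `□̃ = QbigT □`
(the set M5.6 used for (3.95)'s «□̃», `B9Thm39CinvAtCover.chiBigT`) lifted from the member's blocks to sites — and proves the four clauses from landed geometry
(`blkOf_mem_QT_of_hT_ne_zero`, `QT_subset_QbigT`, p21's `hsep_cover` with `D_sep = M∕(2L²)`, `Mh_eq_DsepT`).

OURS ∕ HONEST READING.  Print's `ζ_□̃` is SMOOTH (`C₀^∞(□̃)`); ours is the block indicator of `□̃`.  In (3.105) and in the consumer's families `ζ_□̃` is a LEFT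
multiplier only, and the four clauses above are all that the tree's (R)-design uses; print needs the smoothness of `ζ_□̃` only inside the p. 415 re-expansion of
family 3 (commutators `[ζ_□̃, C_□]`, `[ζ_□̃, G′_□]`), which the (R)-design replaces by a located estimate of `DPD* − DP_□D*` on `□̃`-rows.  If a consumer wants
print's p. 415 road verbatim, a smooth twin with the same four clauses can be added next to this one (a bump of p33's `B9Cor36CubeCutoffs.bumpY` kind); nothing here
forecloses it.  `D_sep = M∕(2L²) = M_h∕(2L)` is p21's explicit constant for «≧ M» (print's generic-constant convention).

WHAT THIS FILE CERTIFIES (kernel-checked; 1 `def` with body, theorems; 0 `def … : Prop`, 0 sorry; standard axioms only)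

* `zetaY i □ : SiteY i → ℝ` (the definition), `zetaY_apply`, `zetaY_eq_ite`, `zetaY_nonneg_le_one`, `abs_zetaY_le_one`, `abs_one_sub_zetaY_le_one`,
  `zetaY_eq_one_of_mem` ∕ `zetaY_eq_zero_of_not_mem` (`□̃`-membership of the site's member block).
* ★ `zetaY_eq_one_of_hTY_ne_zero` (THE CONSUMER's `hζ`), `zetaY_mul_hTY` (`ζ_□̃h_□ = h_□`).
* sections `ιB` (the member carrier's indices): `mem_SQbigT_of_zetaY_ne_zero` (`supp ζ ⊂ S^χ_□`), ★ `not_mem_SQbigT_of_zetaY_ne_one` (rows of `1 − ζ` lie outside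
  `S^χ_□`), `mem_SQT_of_hTY_ne_zero` (rows of `h_□` lie in `S_□`), ★★ `DsepT_le_dist_of_zetaY_ne_one` (`ζ(z) ≠ 1`, `h_□(w) ≠ 0` ⟹ `D_sep ≤ d(βz, βw)`),
  `Mh_div_le_dist_of_zetaY_ne_one` (the same as `M_h∕(2L) ≤ d`).
* bond readings (the consumer's letters `cutMulY (hBdY i ζ)` on `FBondY i`): `hBdY_zetaY_apply`, `abs_hBdY_zetaY_le_one`, `abs_one_sub_hBdY_zetaY_le_one`,
  `hBdY_zetaY_mul_hBdY_hTY`, ★ `cutMulY_zetaY_mul_cutMulY_hTY` (`M_ζ·M_{h_□} = M_{h_□}`), `cutMulY_hTY_mul_cutMulY_zetaY`, and on the member's bond carrier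
  `fun p => ιB (blkV1 i.hN i.D p.1)`: ★★ `DsepT_le_dist_bond` (`ζ♭(f) ≠ 1`, `h♭(g) ≠ 0` ⟹ `D_sep ≤ d(ιB(blkV1 f), ιB(blkV1 g))`), `not_mem_SQbigT_bond`, `mem_SQT_bond`.

NOT CLAIMED.  No operator estimate; no smooth ζ; nothing about families 2–4 themselves (programmes ZETA-2 ∕ FAMFOUR ∕ the family-3 walk).  Count-neutral; NOT a node
discharge; no summit ∕ sub-problem statement is proved; nothing continuum ∕ OS ∕ mass-gap ∕ Clay; YM mass gap NOT proved (Track A conditional rung).  No `sorry`, no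
`axiom`, no `… : Prop` fact, no `instance`, no `notation`.  NEW file; nothing landed is modified.  Cell `lit-balaban`, seat `lit-balaban-p33` gen 102, 2026-08-28;
`--supports stmt-QuantumFields-19200` as helper.  Net new unproved facts: 0.

RELATED IN THE TREE, NOT DUPLICATED (searched 2026-08-28: `rg 'zeta' B9Eq3105*.lean B9Thm310*.lean` = docstrings only; the consumer's `ζ` is a bound variable):
p21 `B9Thm39CinvAtCover` (`chiBigT`, `SQbigT`, `DsepT`, `hsep_cover`), p21∕p38 `B9Thm37GpTorusRegularCubes` (`SQT`, `mem_SQT`), `B6Partition118KLevelTorusCentral`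
(`QbigT`, `QT_subset_QbigT`, `blkOf_mem_QT_of_hT_ne_zero`), p21 `B9Cor36CubeTwinsGeometry.Mh_eq_DsepT` — all USED BY NAME.
-/

noncomputable section

namespace Literature.MathematicalPhysics.QuantumFieldTheory.Balaban1983to89.B9Eq3105ZetaY

open B6KLevelCensusIndexV1 (KIdx)
open B6Cover236MultiLevelBlocks (cubes)
open B6GlobalChartV1 (blkV1)
open B6Geom246MultiLevelBox (blkOf)
open B6Ineq2142KLevelV1 (β)
open B6Partition118KLevelTorusCentral (QT QbigT QT_subset_QbigT blkOf_mem_QT_of_hT_ne_zero)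
open B9GeoNormsKLevelV1 (geo9K)
open B9GeoLemma21KLevelV1 (one_le_Mh)
open B9Thm37CubeCoverCommutators (cutMulY cutMulY_apply hTY hTY_apply)
open B9Thm37CubeCoverCommutatorSizes (side_conditions four_le_P')
open B9Thm37GpTorusRegularCubes (SQT mem_SQT)
open B9Thm39CinvAtCover (chiBigT SQbigT DsepT chiBigT_01 mem_SQbigT hsep_cover)
open B9Cor36CubeTwinsGeometry (Mh_eq_DsepT)
open B9Eq3104CutoffCommutators (hBdY hBdY_apply)
open Node00 (SiteY BlkY IBondY FBondY toKT)
open Node00.OpsYNablaBridge (chartY)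

variable {d ℓ : ℕ} {hd : 1 ≤ d + 1} {hL : Odd (ℓ + 1) ∧ 1 < ℓ + 1} {b₀ b₁ : ℝ}
variable (i : KIdx d ℓ hd hL b₀ b₁) (c : ↥(cubes i.D.toDomains))

/-! ## §1  The definition and its pointwise clauses -/

/-- **`ζ_□̃` OF (3.105), OUR READING**: the indicator of `□̃ = QbigT □` on the member's blocks (p21's `chiBigT`) read at the member block of a site —
`ζ_□̃(z) = 1` if `Δ(z) ⊂ □̃`, else `0`.  (Print: `ζ_□̃ ∈ C₀^∞(□̃)`, `= 1` near □; see the module docstring for the reading.)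
[cite: Balaban1985BackgroundPropagators, (3.105) p.414 («ζ_□̃ is defined similarly to h_□, i.e. ζ_□̃ ∈ C₀^∞(□̃) and ζ_□̃ = 1 on a cube containing □»), p.408; Balaban1984PropagatorsII, p.239 («ζ_□ ∈ C₀^∞(□̃)»)] -/
def zetaY : SiteY i → ℝ := fun z => chiBigT i c (blkOf i.D.toDomains z)

/-- unfolding. [cite: Balaban1985BackgroundPropagators, (3.105) p.414, bookkeeping] -/
theorem zetaY_apply (z : SiteY i) : zetaY i c z = chiBigT i c (blkOf i.D.toDomains z) := rfl

/-- `ζ_□̃(z) = 𝟙[Δ(z) ∈ □̃]`. [cite: Balaban1985BackgroundPropagators, (3.105) p.414, p.408, bookkeeping] -/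
theorem zetaY_eq_ite (z : SiteY i) :
    zetaY i c z = if blkOf i.D.toDomains z ∈ QbigT i.D (one_le_Mh i) (four_le_P' i) c then 1 else 0 := rfl

/-- `0 ≤ ζ_□̃ ≤ 1`. [cite: Balaban1985BackgroundPropagators, (3.105) p.414, bookkeeping] -/
theorem zetaY_nonneg_le_one (z : SiteY i) : 0 ≤ zetaY i c z ∧ zetaY i c z ≤ 1 := chiBigT_01 i c _

/-- `|ζ_□̃| ≤ 1` (the only clause family 4 uses). [cite: Balaban1985BackgroundPropagators, (3.105) p.414, bookkeeping] -/
theorem abs_zetaY_le_one (z : SiteY i) : |zetaY i c z| ≤ 1 := by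
  obtain ⟨h0, h1⟩ := zetaY_nonneg_le_one i c z
  rw [abs_le]; constructor <;> linarith

/-- `|1 − ζ_□̃| ≤ 1`. [cite: Balaban1985BackgroundPropagators, (3.105) p.414, bookkeeping] -/
theorem abs_one_sub_zetaY_le_one (z : SiteY i) : |1 - zetaY i c z| ≤ 1 := by
  obtain ⟨h0, h1⟩ := zetaY_nonneg_le_one i c z
  rw [abs_le]; constructor <;> linarith

/-- `ζ_□̃ = 1` on the sites whose member block lies in `□̃`. [cite: Balaban1985BackgroundPropagators, (3.105) p.414, p.408, bookkeeping] -/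
theorem zetaY_eq_one_of_mem {z : SiteY i} (hz : blkOf i.D.toDomains z ∈ QbigT i.D (one_le_Mh i) (four_le_P' i) c) : zetaY i c z = 1 := by
  rw [zetaY_eq_ite, if_pos hz]

/-- `ζ_□̃ = 0` off `□̃` (`supp ζ_□̃ ⊂ □̃`). [cite: Balaban1985BackgroundPropagators, (3.105) p.414 («ζ_□̃ ∈ C₀^∞(□̃)»), bookkeeping] -/
theorem zetaY_eq_zero_of_not_mem {z : SiteY i} (hz : blkOf i.D.toDomains z ∉ QbigT i.D (one_le_Mh i) (four_le_P' i) c) : zetaY i c z = 0 := by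
  rw [zetaY_eq_ite, if_neg hz]

/-- `ζ_□̃(z) ≠ 0 ⇒ Δ(z) ∈ □̃`. [cite: Balaban1985BackgroundPropagators, (3.105) p.414, bookkeeping] -/
theorem mem_of_zetaY_ne_zero {z : SiteY i} (hz : zetaY i c z ≠ 0) : blkOf i.D.toDomains z ∈ QbigT i.D (one_le_Mh i) (four_le_P' i) c := by
  by_contra h; exact hz (zetaY_eq_zero_of_not_mem i c h)

/-- `ζ_□̃(z) ≠ 1 ⇒ Δ(z) ∉ □̃` (the rows of `1 − ζ_□̃`). [cite: Balaban1985BackgroundPropagators, (3.105) p.414, bookkeeping] -/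
theorem not_mem_of_zetaY_ne_one {z : SiteY i} (hz : zetaY i c z ≠ 1) : blkOf i.D.toDomains z ∉ QbigT i.D (one_le_Mh i) (four_le_P' i) c :=
  fun h => hz (zetaY_eq_one_of_mem i c h)

/-- ★ **THE CONSUMER's `hζ`: `h_□(z) ≠ 0 ⇒ ζ_□̃(z) = 1`** (`supp h_□ ⊂` blocks of `□⁺ = QT □ ⊆ □̃`: `blkOf_mem_QT_of_hT_ne_zero`, `QT_subset_QbigT`).
[cite: Balaban1985BackgroundPropagators, (3.105) p.414 («ζ_□̃ = 1 on a cube containing □»), p.408; Balaban1984PropagatorsII, p.235, (2.36) p.229] -/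
theorem zetaY_eq_one_of_hTY_ne_zero {z : SiteY i} (hz : hTY i c z ≠ 0) : zetaY i c z = 1 := by
  obtain ⟨_, hMh2, hR, _⟩ := side_conditions i
  have hQ := blkOf_mem_QT_of_hT_ne_zero (D := i.D) hMh2 hR (hMh1 := one_le_Mh i) (four_le_P' i) c (by rwa [hTY_apply] at hz)
  exact zetaY_eq_one_of_mem i c (QT_subset_QbigT (D := i.D) (one_le_Mh i) (four_le_P' i) c hQ)

/-- `ζ_□̃·h_□ = h_□`. [cite: Balaban1985BackgroundPropagators, p.415 («Using the fact that ζ_□̃h_□ = h_□»)] -/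
theorem zetaY_mul_hTY (z : SiteY i) : zetaY i c z * hTY i c z = hTY i c z := by
  by_cases h : hTY i c z = 0
  · rw [h, mul_zero]
  · rw [zetaY_eq_one_of_hTY_ne_zero i c h, one_mul]

/-! ## §2  The clauses on the member's index carrier (a section `ιB` of `β`) and the separation -/

section Carrier

variable [Fintype (geo9K i).Site] (ιB : BlkY i → IBondY i) (hι : ∀ s, β i.hN i.D i.hk (ιB s) = s)

include hι

/-- `supp ζ_□̃ ⊂ S^χ_□` (indices of `□̃`). [cite: Balaban1985BackgroundPropagators, (3.105) p.414, (3.95) p.411, bookkeeping] -/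
theorem mem_SQbigT_of_zetaY_ne_zero {z : SiteY i} (hz : zetaY i c z ≠ 0) : ιB (blkOf i.D.toDomains z) ∈ SQbigT i c := by
  refine (mem_SQbigT i c _).2 ?_
  rw [hι]; exact mem_of_zetaY_ne_zero i c hz

/-- ★ the ROWS of `1 − ζ_□̃` lie OUTSIDE `S^χ_□`. [cite: Balaban1985BackgroundPropagators, (3.105) p.414, (3.95) p.411, bookkeeping] -/
theorem not_mem_SQbigT_of_zetaY_ne_one {z : SiteY i} (hz : zetaY i c z ≠ 1) : ιB (blkOf i.D.toDomains z) ∉ SQbigT i c := by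
  intro h
  have h' := (mem_SQbigT i c _).1 h
  rw [hι] at h'
  exact not_mem_of_zetaY_ne_one i c hz h'

/-- the rows of `h_□` lie in `S_□` (indices of `□⁺`). [cite: Balaban1985BackgroundPropagators, (3.87) p.409, p.408; Balaban1984PropagatorsII, p.235] -/
theorem mem_SQT_of_hTY_ne_zero {w : SiteY i} (hw : hTY i c w ≠ 0) : ιB (blkOf i.D.toDomains w) ∈ SQT i c := by
  obtain ⟨_, hMh2, hR, _⟩ := side_conditions i
  refine (mem_SQT i c _).2 ?_
  rw [hι]
  exact blkOf_mem_QT_of_hT_ne_zero (D := i.D) hMh2 hR (hMh1 := one_le_Mh i) (four_le_P' i) c (by rwa [hTY_apply] at hw)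

/-- ★★ **THE SEPARATION `supp(1 − ζ_□̃)` ∕ `supp h_□` IN THE MEMBER's BLOCK DISTANCE**: `ζ_□̃(z) ≠ 1`, `h_□(w) ≠ 0` ⟹ `D_sep = M∕(2L²) ≤ d(βz, βw)` (p21's
`hsep_cover`). [cite: Balaban1985BackgroundPropagators, (3.105) p.414 («supp h_□ is separated from supp (1 − ζ_□̃) by a distance ≧ M»), p.411; Balaban1984PropagatorsII, (2.83) p.237, (2.46) p.231] -/
theorem DsepT_le_dist_of_zetaY_ne_one {z w : SiteY i} (hz : zetaY i c z ≠ 1) (hw : hTY i c w ≠ 0) :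
    DsepT i ≤ (geo9K i).dist (ιB (blkOf i.D.toDomains z)) (ιB (blkOf i.D.toDomains w)) :=
  hsep_cover i c _ (not_mem_SQbigT_of_zetaY_ne_one i c ιB hι hz) _ (mem_SQT_of_hTY_ne_zero i c ιB hι hw)

/-- the same with `D_sep` spelled `M_h∕(2L)` (`Mh_eq_DsepT`). [cite: Balaban1985BackgroundPropagators, (3.105) p.414, p.411, bookkeeping] -/
theorem Mh_div_le_dist_of_zetaY_ne_one {z w : SiteY i} (hz : zetaY i c z ≠ 1) (hw : hTY i c w ≠ 0) :
    ((toKT i).Mh : ℝ) / (2 * ((ℓ : ℝ) + 1)) ≤ (geo9K i).dist (ιB (blkOf i.D.toDomains z)) (ιB (blkOf i.D.toDomains w)) := by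
  have h := DsepT_le_dist_of_zetaY_ne_one i c ιB hι hz hw
  have hL : (0 : ℝ) < 2 * ((ℓ : ℝ) + 1) := by positivity
  rw [div_le_iff₀ hL]
  calc ((toKT i).Mh : ℝ) = 2 * ((ℓ : ℝ) + 1) * DsepT i := Mh_eq_DsepT i
    _ ≤ 2 * ((ℓ : ℝ) + 1) * (geo9K i).dist (ιB (blkOf i.D.toDomains z)) (ιB (blkOf i.D.toDomains w)) := mul_le_mul_of_nonneg_left h hL.le
    _ = (geo9K i).dist (ιB (blkOf i.D.toDomains z)) (ιB (blkOf i.D.toDomains w)) * (2 * ((ℓ : ℝ) + 1)) := by ring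

end Carrier

/-! ## §3  Bond readings: the consumer's letters `M_{ζ_□̃} = cutMulY (hBdY i ζ_□̃)` on `FBondY i` and the member's bond carrier `ιB ∘ blkV1` -/

section Bond

/-- `ζ_□̃♭(f) = ζ_□̃(f₋)`. [cite: Balaban1985BackgroundPropagators, (3.87) p.409, bookkeeping] -/
theorem hBdY_zetaY_apply (f : FBondY i) : hBdY i (zetaY i c) f = zetaY i c (chartY i f.src) := rfl

/-- `|ζ_□̃♭| ≤ 1`. [cite: Balaban1985BackgroundPropagators, (3.105) p.414, bookkeeping] -/
theorem abs_hBdY_zetaY_le_one (f : FBondY i) : |hBdY i (zetaY i c) f| ≤ 1 := abs_zetaY_le_one i c _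

/-- `|1 − ζ_□̃♭| ≤ 1`. [cite: Balaban1985BackgroundPropagators, (3.105) p.414, bookkeeping] -/
theorem abs_one_sub_hBdY_zetaY_le_one (f : FBondY i) : |1 - hBdY i (zetaY i c) f| ≤ 1 := abs_one_sub_zetaY_le_one i c _

/-- `ζ_□̃♭·h_□♭ = h_□♭`. [cite: Balaban1985BackgroundPropagators, p.415 («ζ_□̃h_□ = h_□»), bookkeeping] -/
theorem hBdY_zetaY_mul_hBdY_hTY (f : FBondY i) : hBdY i (zetaY i c) f * hBdY i (hTY i c) f = hBdY i (hTY i c) f := zetaY_mul_hTY i c _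

variable {𝔸 : Type} [NormedRing 𝔸] [NormedAlgebra ℂ 𝔸]

/-- ★ **`M_{ζ_□̃}·M_{h_□} = M_{h_□}`** on the bond functions. [cite: Balaban1985BackgroundPropagators, p.415 («ζ_□̃h_□ = h_□»), (3.87) p.409] -/
theorem cutMulY_zetaY_mul_cutMulY_hTY :
    cutMulY (𝔸 := 𝔸) (hBdY i (zetaY i c)) * cutMulY (𝔸 := 𝔸) (hBdY i (hTY i c)) = cutMulY (𝔸 := 𝔸) (hBdY i (hTY i c)) := by
  refine LinearMap.ext fun v => funext fun f => ?_
  simp only [Module.End.mul_apply, cutMulY_apply, smul_smul, ← Complex.ofReal_mul]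
  rw [hBdY_zetaY_mul_hBdY_hTY]

/-- `M_{h_□}·M_{ζ_□̃} = M_{h_□}`. [cite: Balaban1985BackgroundPropagators, p.415, (3.87) p.409, bookkeeping] -/
theorem cutMulY_hTY_mul_cutMulY_zetaY :
    cutMulY (𝔸 := 𝔸) (hBdY i (hTY i c)) * cutMulY (𝔸 := 𝔸) (hBdY i (zetaY i c)) = cutMulY (𝔸 := 𝔸) (hBdY i (hTY i c)) := by
  refine LinearMap.ext fun v => funext fun f => ?_
  simp only [Module.End.mul_apply, cutMulY_apply, smul_smul, ← Complex.ofReal_mul]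
  rw [mul_comm, hBdY_zetaY_mul_hBdY_hTY]

variable [Fintype (geo9K i).Site] (ιB : BlkY i → IBondY i) (hι : ∀ s, β i.hN i.D i.hk (ιB s) = s)

include hι

/-- ★★ **THE SEPARATION ON THE MEMBER's BOND CARRIER** `fun p => ιB (blkV1 i.hN i.D p.1)`: `ζ_□̃♭(f) ≠ 1`, `h_□♭(g) ≠ 0` ⟹ `D_sep ≤ d(ιB(Δ(f₋)), ιB(Δ(g₋)))`.
[cite: Balaban1985BackgroundPropagators, (3.105) p.414 («separated … by a distance ≧ M»), p.411; Balaban1984PropagatorsII, (2.83) p.237] -/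
theorem DsepT_le_dist_bond {f g : FBondY i} (hf : hBdY i (zetaY i c) f ≠ 1) (hg : hBdY i (hTY i c) g ≠ 0) :
    DsepT i ≤ (geo9K i).dist (ιB (blkV1 i.hN i.D f)) (ιB (blkV1 i.hN i.D g)) :=
  DsepT_le_dist_of_zetaY_ne_one i c ιB hι hf hg

/-- rows of `1 − ζ_□̃♭` are outside `S^χ_□`. [cite: Balaban1985BackgroundPropagators, (3.105) p.414, bookkeeping] -/
theorem not_mem_SQbigT_bond {f : FBondY i} (hf : hBdY i (zetaY i c) f ≠ 1) : ιB (blkV1 i.hN i.D f) ∉ SQbigT i c :=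
  not_mem_SQbigT_of_zetaY_ne_one i c ιB hι hf

/-- rows of `h_□♭` are in `S_□`. [cite: Balaban1985BackgroundPropagators, (3.87) p.409, p.408, bookkeeping] -/
theorem mem_SQT_bond {g : FBondY i} (hg : hBdY i (hTY i c) g ≠ 0) : ιB (blkV1 i.hN i.D g) ∈ SQT i c :=
  mem_SQT_of_hTY_ne_zero i c ιB hι hg

end Bond

end Literature.MathematicalPhysics.QuantumFieldTheory.Balaban1983to89.B9Eq3105ZetaY

end
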